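import Literature.AnabelianGeometry.SemiGraphs.ArithLevelData
import Literature.AnabelianGeometry.SemiGraphs.SubdivisionLemmas
import Mathlib.CategoryTheory.Endomorphism
import Mathlib.GroupTheory.QuotientGroup.Basic
import HarnessLib

/-!
# Unique lifting along immersions of semi-graphs; rigidity of deck transformations; finiteness of
# the vertex stabilisers of `Gal(𝒢_{∞,j}/𝒢)` acting on the tree `𝒢_{∞,j}` ([SemiAnbd] §1 p. 14, §3 p. 41)

Mochizuki, *Semi-graphs of anabelioids*, Publ. RIMS **42** (2006), §1 pp. 13–14 (immersions,
graph-coverings; Prop 1.1's local-injectivity argument on the associated topological space), §3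
Thm 3.7 (iii) proof p. 41 (the action of `π₁^temp(𝒢)` on the universal graph-coverings `𝒢_{∞,i}` of
the finite étale Galois coverings `𝒢_i` "factors through a finite quotient"), §5 p. 65 / Rmk 5.3.1
(compactness of the decomposition groups), kurims `paper:url-f33ace170ff4`.
[cite: MochizukiSemiAnbd2006, Thm 3.7 (iii), p. 41]

PROOF-ONLY file (abc-iut-w4-d053 gen 2; sub-DAG `plan/L3/SUBDAG-SemiAnbd-Thm54.md`, producer row
T54-B, GAP-LEDGER G-w4d053-1).  It supplies, GENERICALLY and in the currency of
`ArithLevelData` (ArithLevelData.lean), the one tower input `hfin` of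
`ProfiniteSemiGraph.isCompact_arithVertGp_of_forall_fixes` (TemperedClosedSubgroupCompact.lean, the
LEVEL-B binder `hVc` of [SemiAnbd] Thm 5.4 (i)∧(ii)): the image of a pro-vertex stabiliser in
`Π^temp_𝔊 / ker(actⱼ)` is finite at every level `j`.

* `SemiGraph.hom_ext_of_comp_immersion` — UNIQUE LIFTING: two morphisms `φ ψ : A ⟶ T` from a
  CONNECTED semi-graph with `φ ≫ q = ψ ≫ q` for an IMMERSION `q : T ⟶ B`, agreeing at one vertex,
  are equal (the node maps on barycentric subdivisions agree on a set containing a vertex-point and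
  closed under adjacency, by local injectivity of the node map of `q` — the argument of Prop 1.1).
* `SemiGraph.eq_id_of_comp_eq_of_vertexMap_eq` / `SemiGraph.aut_eq_one_of_comp_eq_of_vertexMap_eq` —
  RIGIDITY OF DECK TRANSFORMATIONS: an endomorphism / automorphism of a connected `T` over an
  immersion `T ⟶ B` fixing a vertex is the identity.
* `SemiGraph.finite_edge_of_finite_branch`, `SemiGraph.finite_aut` — a semi-graph with finitely many
  vertices and branches has finitely many edges (every edge has two branches) and automorphisms.
* `SemiGraph.finite_image_stabilizer_quotient_ker` — for actions `act : G →* Aut T`,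
  `levelAct : G →* Aut 𝔾ⱼ` intertwined by an immersion `quot : T ⟶ 𝔾ⱼ` (`T` connected, `𝔾ⱼ` finite):
  the image of the stabiliser `{g | act g · x = x}` in `G / ker act` is finite (it injects into the
  image of `levelAct`, since `act g` is pinned by `levelAct g` and `act g · x = x`, unique lifting).
* `ArithLevelData.finite_image_fixes_quotient_ker` — the same for the system stabiliser
  `{g | ∀ i, actᵢ g · xᵢ = xᵢ}` of an `ArithLevelData` (trees `T_j`, immersions `quot j` onto the
  finite levels, `act_quot`), at every level `j`: THE TOWER INPUT `hfin` of `hVc` modulo the passage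
  from `ker(act j)` to a basic open subgroup (`finite_image_quotient_inf` / `_comap`,
  TemperedClosedSubgroupCompact.lean).

Nothing here asserts a statement of [SemiAnbd] beyond what is proved; typed ≠ proved; no side taken
on [IUTchIII] Cor 3.12.
-/

namespace Literature.AnabelianGeometry.SemiGraphs

open CategoryTheory

universe u

namespace SemiGraph

variable {A T B : SemiGraph.{u}}

/-- The node map `Sum.map φ.vertexMap (Sum.map φ.edgeMap φ.branchMap)` on barycentric subdivisions
is functorial. [cite: MochizukiSemiAnbd2006, §1 p.11] -/
private theorem nodeMap_hom_comp (φ : A ⟶ T) (q : T ⟶ B) (n : A.Node) :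
    Sum.map (φ ≫ q).vertexMap (Sum.map (φ ≫ q).edgeMap (φ ≫ q).branchMap) n =
      Sum.map q.vertexMap (Sum.map q.edgeMap q.branchMap)
        (Sum.map φ.vertexMap (Sum.map φ.edgeMap φ.branchMap) n) := by
  rcases n with v | e | b <;> rfl

/-- The node map of an IMMERSION is locally injective: two neighbours of one node with the same
image coincide (at a vertex-point: the immersion condition; at an edge-point: injectivity on the two
branches of an edge; at a branch-point: its neighbours have distinct types or coincide).
[cite: MochizukiSemiAnbd2006, Prop. 1.1 p.14] -/
private theorem nodeMap_locallyInjective_of_isImmersion (q : T ⟶ B) (hq : IsImmersion q)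
    ⦃x y z : T.Node⦄ (hy : T.subdivision.Adj x y) (hz : T.subdivision.Adj x z)
    (hyz : Sum.map q.vertexMap (Sum.map q.edgeMap q.branchMap) y =
      Sum.map q.vertexMap (Sum.map q.edgeMap q.branchMap) z) : y = z := by
  rcases x with v | e | b
  · obtain ⟨b₁, hb₁, rfl⟩ := (T.subdivision_adj_inl_iff v y).1 hy
    obtain ⟨b₂, hb₂, rfl⟩ := (T.subdivision_adj_inl_iff v z).1 hz
    have h : q.branchMap b₁ = q.branchMap b₂ := by simpa using hyz
    have := hq v (a₁ := ⟨b₁, hb₁⟩) (a₂ := ⟨b₂, hb₂⟩) (Subtype.ext h)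
    rw [Subtype.mk.injEq] at this
    rw [this]
  · obtain ⟨b₁, hb₁, rfl⟩ := (T.subdivision_adj_edge_iff e y).1 hy
    obtain ⟨b₂, hb₂, rfl⟩ := (T.subdivision_adj_edge_iff e z).1 hz
    have h : q.branchMap b₁ = q.branchMap b₂ := by simpa using hyz
    rw [q.branchMap_injOn b₁ b₂ (hb₁.trans hb₂.symm) h]
  · rcases (T.subdivision_adj_branch_iff b y).1 hy with rfl | ⟨v₁, hv₁, rfl⟩ <;>
      rcases (T.subdivision_adj_branch_iff b z).1 hz with rfl | ⟨v₂, hv₂, rfl⟩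
    · rfl
    · simp at hyz
    · simp at hyz
    · rw [hv₁] at hv₂
      cases hv₂
      rfl

/-- **Unique lifting along an immersion** ([SemiAnbd] §1 p. 14, the local-injectivity argument of
Prop 1.1): two morphisms `φ ψ : A ⟶ T` from a CONNECTED semi-graph `A`, lying over the same morphism
to `B` through an IMMERSION `q : T ⟶ B` (`φ ≫ q = ψ ≫ q`) and agreeing at one vertex, are equal.
[cite: MochizukiSemiAnbd2006, Prop. 1.1 p.14] -/
theorem hom_ext_of_comp_immersion (q : T ⟶ B) (hq : IsImmersion q) (hA : A.IsConnected)
    (φ ψ : A ⟶ T) (h : φ ≫ q = ψ ≫ q) (v : A.Vertex) (hv : φ.vertexMap v = ψ.vertexMap v) :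
    φ = ψ := by
  -- node maps
  let F : (A ⟶ T) → A.Node → T.Node := fun χ => Sum.map χ.vertexMap (Sum.map χ.edgeMap χ.branchMap)
  -- the set of nodes where the node maps agree is closed under adjacency
  have hstep : ∀ ⦃n m : A.Node⦄, A.subdivision.Adj n m → F φ n = F ψ n → F φ m = F ψ m := by
    intro n m hnm hn
    have h1 : T.subdivision.Adj (F ψ n) (F φ m) := by
      rw [← hn]
      exact subdivision_adj_map φ hnm
    have h2 : T.subdivision.Adj (F ψ n) (F ψ m) := subdivision_adj_map ψ hnm
    refine nodeMap_locallyInjective_of_isImmersion q hq h1 h2 ?_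
    change Sum.map q.vertexMap (Sum.map q.edgeMap q.branchMap)
        (Sum.map φ.vertexMap (Sum.map φ.edgeMap φ.branchMap) m) =
      Sum.map q.vertexMap (Sum.map q.edgeMap q.branchMap)
        (Sum.map ψ.vertexMap (Sum.map ψ.edgeMap ψ.branchMap) m)
    rw [← nodeMap_hom_comp, ← nodeMap_hom_comp, h]
  -- … and contains the vertex-point of `v`, hence is everything (`A` connected)
  have key : ∀ n : A.Node, F φ n = F ψ n := by
    have hv' : F φ (Sum.inl v) = F ψ (Sum.inl v) := by
      simp [F, hv]
    have hwalk : ∀ {n m : A.Node} (p : A.subdivision.Walk n m), F φ n = F ψ n → F φ m = F ψ m := by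
      intro n m p
      induction p with
      | nil => exact id
      | cons hadj p ih => exact fun hn => ih (hstep hadj hn)
    intro n
    obtain ⟨p⟩ := hA.connected.preconnected (Sum.inl v) n
    exact hwalk p hv'
  refine hom_ext φ ψ (funext fun w => ?_) (funext fun e => ?_) (funext fun b => ?_)
  · simpa [F] using key (Sum.inl w)
  · simpa [F] using key (Sum.inr (Sum.inl e))
  · simpa [F] using key (Sum.inr (Sum.inr b))

/-- **Rigidity of deck transformations**: an endomorphism of a connected semi-graph `T` over an
immersion `q : T ⟶ B` (`φ ≫ q = q`) that fixes one vertex is the identity.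
[cite: MochizukiSemiAnbd2006, Prop. 1.1 p.14] -/
theorem eq_id_of_comp_eq_of_vertexMap_eq (q : T ⟶ B) (hq : IsImmersion q) (hT : T.IsConnected)
    (φ : T ⟶ T) (h : φ ≫ q = q) (x : T.Vertex) (hx : φ.vertexMap x = x) : φ = 𝟙 T :=
  hom_ext_of_comp_immersion q hq hT φ (𝟙 T) (by simpa using h) x (by simpa using hx)

/-- Rigidity of deck transformations, `Aut` form: an automorphism of a connected `T` over an
immersion `T ⟶ B` fixing a vertex is `1`. [cite: MochizukiSemiAnbd2006, Prop. 1.1 p.14] -/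
theorem aut_eq_one_of_comp_eq_of_vertexMap_eq (q : T ⟶ B) (hq : IsImmersion q) (hT : T.IsConnected)
    (σ : Aut T) (h : σ.hom ≫ q = q) (x : T.Vertex) (hx : σ.hom.vertexMap x = x) : σ = 1 :=
  Iso.ext (eq_id_of_comp_eq_of_vertexMap_eq q hq hT σ.hom h x hx)

/-! ### Finiteness of `Aut` of a finite semi-graph -/

/-- A semi-graph with finitely many branches has finitely many edges (every edge is a set of two
branches). [cite: MochizukiSemiAnbd2006, §1 p.11] -/
theorem finite_edge_of_finite_branch (L : SemiGraph.{u}) [Finite L.Branch] : Finite L.Edge :=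
  Finite.of_surjective L.edgeOf fun e => by
    obtain ⟨b₁, -, -, h₁, -⟩ := L.two_branches e
    exact ⟨b₁, h₁⟩

/-- A semi-graph with finitely many vertices and branches has finitely many automorphisms (a
morphism is determined by its three maps). [cite: MochizukiSemiAnbd2006, §1 p.11] -/
theorem finite_aut (L : SemiGraph.{u}) [Finite L.Vertex] [Finite L.Branch] : Finite (Aut L) := by
  haveI := finite_edge_of_finite_branch L
  refine Finite.of_injective
    (fun σ : Aut L => (σ.hom.vertexMap, σ.hom.edgeMap, σ.hom.branchMap)) ?_
  intro σ τ hστ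
  simp only [Prod.mk.injEq] at hστ
  exact Iso.ext (hom_ext _ _ hστ.1 hστ.2.1 hστ.2.2)

/-! ### Finite vertex stabilisers modulo the kernel -/

/-- **Finite vertex stabilisers of `Gal(𝒢_{∞,j}/𝒢)` on the tree** ([SemiAnbd] p. 41: the action on
`𝒢_{∞,j}` covers the action on the FINITE level `𝔾_j` through a finite quotient): for actions
`act : G →* Aut T` and `levelAct : G →* Aut L` intertwined by an IMMERSION `quot : T ⟶ L`
(`(act g) ≫ quot = quot ≫ (levelAct g)`), `T` connected and `L` finite, the image in `G / ker act`
of the stabiliser of a vertex `x` of `T` is finite — indeed `act g` is determined by `levelAct g`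
once `act g` fixes `x` (unique lifting), and `Aut L` is finite.
[cite: MochizukiSemiAnbd2006, Thm 3.7 (iii), p. 41] -/
theorem finite_image_stabilizer_quotient_ker {G : Type*} [Group G] {T L : SemiGraph.{u}}
    (act : G →* Aut T) (levelAct : G →* Aut L) (quot : T ⟶ L) (hq : IsImmersion quot)
    (hT : T.IsConnected) (hquot : ∀ g : G, (act g).hom ≫ quot = quot ≫ (levelAct g).hom)
    [Finite L.Vertex] [Finite L.Branch] (x : T.Vertex) :
    ((QuotientGroup.mk : G → G ⧸ act.ker) '' {g : G | (act g).hom.vertexMap x = x}).Finite := by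
  classical
  haveI := finite_aut L
  -- inside the stabiliser, `act g` is determined by `levelAct g`
  have hconst : ∀ g₁ g₂ : G, (act g₁).hom.vertexMap x = x → (act g₂).hom.vertexMap x = x →
      levelAct g₁ = levelAct g₂ → act g₁ = act g₂ := by
    intro g₁ g₂ h₁ h₂ hl
    apply Iso.ext
    exact hom_ext_of_comp_immersion quot hq hT _ _ (by rw [hquot, hquot, hl]) x (h₁.trans h₂.symm)
  -- a function `Aut L → G / ker act` whose range contains the image of the stabiliser
  let F : Aut L → G ⧸ act.ker := fun ψ =>
    if hψ : ∃ g : G, (act g).hom.vertexMap x = x ∧ levelAct g = ψ then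
      (QuotientGroup.mk hψ.choose : G ⧸ act.ker) else 1
  refine (Set.finite_range F).subset ?_
  rintro _ ⟨g, hg, rfl⟩
  refine ⟨levelAct g, ?_⟩
  have hex : ∃ g' : G, (act g').hom.vertexMap x = x ∧ levelAct g' = levelAct g := ⟨g, hg, rfl⟩
  simp only [F, dif_pos hex]
  rw [QuotientGroup.eq, MonoidHom.mem_ker, map_mul, map_inv,
    hconst _ g hex.choose_spec.1 hg hex.choose_spec.2, inv_mul_cancel]

/-- The same for the stabiliser of a SYSTEM of vertices under a family of actions: at each level
`j`, the image in `G / ker (act j)` of `{g | ∀ i, (act i g) · x_i = x_i}` is finite.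
[cite: MochizukiSemiAnbd2006, Thm 3.7 (iii), p. 41] -/
theorem finite_image_systemStabilizer_quotient_ker {G : Type*} [Group G] {J : Type*}
    {T L : J → SemiGraph.{u}} (act : ∀ j, G →* Aut (T j)) (levelAct : ∀ j, G →* Aut (L j))
    (quot : ∀ j, T j ⟶ L j) (hq : ∀ j, IsImmersion (quot j)) (hT : ∀ j, (T j).IsConnected)
    (hquot : ∀ (j : J) (g : G), (act j g).hom ≫ quot j = quot j ≫ (levelAct j g).hom)
    [∀ j, Finite (L j).Vertex] [∀ j, Finite (L j).Branch] (x : ∀ j, (T j).Vertex) (j : J) :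
    ((QuotientGroup.mk : G → G ⧸ (act j).ker) ''
      {g : G | ∀ i, (act i g).hom.vertexMap (x i) = x i}).Finite :=
  (finite_image_stabilizer_quotient_ker (act j) (levelAct j) (quot j) (hq j) (hT j) (hquot j)
    (x j)).subset (Set.image_mono fun _ hg => hg j)

end SemiGraph

/-! ### In `ArithLevelData` currency: the tower input `hfin` of `hVc` -/

namespace ArithLevelData

variable {Gtp : Type*} [Group Gtp] [TopologicalSpace Gtp] {PA : Type*} [Group PA]
  {𝔾 : SemiGraph.{u}} {D : DecompositionData Gtp 𝔾.Vertex 𝔾.Branch} {aug : Gtp →* PA}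
  {baseAct : PA →* Aut 𝔾}

/-- **The tower input of `hVc`** ([SemiAnbd] p. 41 / p. 65): for arithmetic level data `L` (trees
`T_j` with `Π^temp_𝔊`-actions covering the actions on the FINITE levels `𝔾_j` through the
graph-coverings `quot j`, which are immersions), the stabiliser of any system of tree vertices has
finite image in `Π^temp_𝔊 / ker(act j)` at every level `j`.  Feeds
`ProfiniteSemiGraph.isCompact_arithVertGp_of_forall_fixes` (TemperedClosedSubgroupCompact.lean) once
the basic open subgroups of `Π^temp_𝔊` are compared with the `ker(act j)`
(`finite_image_quotient_inf` / `finite_image_quotient_comap`).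
[cite: MochizukiSemiAnbd2006, Rmk 5.3.1, p. 65] -/
theorem finite_image_fixes_quotient_ker (L : ArithLevelData 𝔾 D aug baseAct)
    (x : ∀ j, (L.tree j).Vertex) (j : L.J) :
    ((QuotientGroup.mk : Gtp → Gtp ⧸ (L.act j).ker) ''
      {g : Gtp | ∀ i, (L.act i g).hom.vertexMap (x i) = x i}).Finite :=
  haveI := L.finiteVertex
  haveI := L.finiteBranch
  SemiGraph.finite_image_systemStabilizer_quotient_ker L.act L.levelAct L.quot L.quot_isImmersion
    (fun i => ⟨(L.isTree i).isTree.connected⟩) L.act_quot x j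

end ArithLevelData

end Literature.AnabelianGeometry.SemiGraphs
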